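import Mathlib.LinearAlgebra.TensorPower.Basic
import Mathlib.LinearAlgebra.PiTensorProduct.Basic
import Mathlib.LinearAlgebra.Matrix.GeneralLinearGroup.Defs
import Mathlib.LinearAlgebra.GeneralLinearGroup.Basic
import Mathlib.Data.Prod.Lex
import Mathlib.RepresentationTheory.Basic
import Mathlib.RepresentationTheory.Irreducible
import Mathlib.Algebra.MvPolynomial.Rename
import Literature.NumberTheory.DiophantineGeometry.PartitionTableaux
import Literature.NumberTheory.DiophantineGeometry.GLHighestWeight
import Literature.NumberTheory.DiophantineGeometry.SymmetricGroupReps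
import Literature.Computability.AlgebraicComplexity.LinSubst
import Literature.Computability.AlgebraicComplexity.OrbitClosure
import Literature.Computability.AlgebraicComplexity.OrbitCoordinateRing
import Literature.Computability.AlgebraicComplexity.StandardFamilies
import HarnessLib

-- provenance: harness21/H21/H21/Prelude/ArithGeomL/SchurWeylPlethysm.lean @ fb77e70 (interim HEAD d8f2665); M5 mechanical rewrite
/-!
# Weyl modules, Schur–Weyl duality, plethysm and GCT multiplicities
(trunk ArithGeomL / CplxAlg, item C9)

Notion `gl_sn_irreps_partitions`, part 3, and notion `gct_orbit_closure` (multiplicities).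

1. **Tensor powers.** On `V^{⊗d} = TensorPower k d V` we have the commuting actions of the
   symmetric group `S_d = Equiv.Perm (Fin d)` (permuting the factors, `permTensorRep`) and of
   `GL(V)` (diagonally, `diagTensorRep`); for `V = k^σ` the latter is `glTensorRep σ k d`, a
   representation of `GL σ k = Matrix.GeneralLinearGroup σ k` through the *column* action
   `v ↦ g *ᵥ v` (Mathlib `Matrix.GeneralLinearGroup.toLin`, whose underlying linear map is
   `Matrix.mulVecLin`). This is the same convention as G20's `linSubst`
   (`X i ↦ ∑ j, g j i • X j`, i.e. the basis vector `X i = e_i` goes to the `i`-th column of `g`),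
   so highest weights below are taken for the same upper triangular Borel as in
   `GLHighestWeight`.
2. **Weyl modules.** `weylModule k σ μ = c_μ · (k^σ)^{⊗d} ⊆ (k^σ)^{⊗d}` is the image of the Young
   symmetrizer `c_μ ∈ k[S_d]` (`youngSymmetrizer`, file `SymmetricGroupReps`); it is
   `GL σ k`-stable (`glTensorRep_mem_weylModule`) and `weylRep k σ μ` is the induced
   representation `S_μ(k^σ)`. Theorems (sorried, classical): irreducibility in characteristic
   zero, vanishing iff `μ` has more than `|σ|` parts, highest weight `= μ`, the existence half of
   the highest-weight classification of polynomial irreducibles (a corollary, stated here and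
   not in `GLHighestWeight`), and Schur–Weyl duality in the form
   `hwMultiplicity (glTensorRep (Fin N) k d) μ = f^μ = numStandardTableaux μ`.
3. **Plethysm and GCT multiplicities.** For G20's representation `coordRep σ k m` of `GL σ k` on
   `k[Sym^m (k^σ)] = ⊕_d Sym^d (Sym^m (k^σ))^*` (`(g · F)(v) = F(g⁻¹ v)`, a sum of *duals* of
   polynomial representations) and its quotient `orbitCoordRep f m` on the coordinate ring
   `k[Δ_m[f]]` of an orbit closure, the multiplicities `plethysmCoeff`, `orbitMultiplicity` of a
   highest weight `χ` are `hwMultiplicity` (file `GLHighestWeight`). Matrix spaces are indexed by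
   `MatIdx m = Fin m ×ₗ Fin m` (lexicographic order, so that "upper triangular" makes sense), and
   `detFormLex`, `paddedPerFormLex`, `detOrbitRep`, `paddedPerOrbitRep` are G20's determinant,
   padded permanent and orbit-closure coordinate rings transported along `toLex`. The BLMW
   bounds `orbitMultiplicity ≤ plethysmCoeff` and (for `det_m`) `≤` a rectangular Kronecker
   coefficient are stated.

## Sources

* W. Fulton, J. Harris, *Representation Theory. A First Course*, GTM 129 (1991), §6.1
  (Thm 6.3, Schur–Weyl duality and Weyl's construction), §15.5 (Thm 15.47).
* W. Fulton, *Young Tableaux*, LMS Student Texts 35 (1997), §8.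
* J. A. Green, *Polynomial Representations of `GL_n`*, LNM 830 (1980), Ch. 3–5.
* P. Bürgisser, J. M. Landsberg, L. Manivel, J. Weyman, *An overview of mathematical issues
  arising in the geometric complexity theory approach to VP ≠ VNP*, SIAM J. Comput. 40 (2011),
  §4–§5 (Prop. 4.4.1, Prop. 5.2.1, formula (5.2.2)).
* P. Bürgisser, C. Ikenmeyer, *Geometric complexity theory and tensor rank*, STOC 2011;
  *Explicit lower bounds via geometric complexity theory*, STOC 2013, §2.
* K. Mulmuley, M. Sohoni, *Geometric complexity theory I*, SIAM J. Comput. 31 (2001), §4–§5.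

## Mathlib

Used (grep at this pin): `TensorPower`, `PiTensorProduct.reindex` (`reindex_refl`,
`reindex_trans`, `reindex_tprod`, `map_comp_reindex_eq`), `PiTensorProduct.mapMonoidHom`,
`LinearEquiv.automorphismGroup.toLinearMapMonoidHom`, `Matrix.GeneralLinearGroup.toLin`
(`coe_toLin : … = Matrix.mulVecLin`), `LinearMap.GeneralLinearGroup.generalLinearEquiv`,
`Representation.asAlgebraHom`, `Representation.subrepresentation`, `Representation.IsIrreducible`,
`Lex`/`×ₗ` with `Prod.Lex.instLinearOrder` and `Lex.fintype`, `finProdFinEquiv`,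
`MvPolynomial.rename`, `OrderIso` (`StrictMono.le_iff_le`). Mathlib has no Weyl/Schur modules of
`GL_n` and no Schur functors (grepping `Schur` at this pin finds only Schur's lemma, Schur
complements, Schur–Zassenhaus and Schur's theorem on Frobenius numbers; `Weyl` finds Weyl groups
of root systems and Weyl's equidistribution criterion), no Schur–Weyl duality, no plethysm or
Kronecker coefficients; this file supplies statement-level versions.

## Design

* Everything lives in `namespace Literature.CplxAlg`. The tensor-power representations are defined for
  a commutative ring `k`; from the Weyl modules on, `k` is a field (as in `GLHighestWeight`,
  `SymmetricGroupReps`), and theorems needing it carry `[CharZero k]`.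
* `weylRep k σ μ` is `Representation.subrepresentation` of `glTensorRep` on `weylModule`, exactly
  as G20's `formRep`; the `GL`-stability it needs is the theorem `glTensorRep_mem_weylModule`,
  which is PROVED here (the two actions commute, `permTensorRep_comp_diagTensorRep`), so no
  sorried lemma feeds a definition and the outline's fallback hypothesis argument `h` is not
  needed (review, first audit, item 1).
* **Elaboration note.** In `HasHighestWeight ρ χ`, `Representation.IsIrreducible ρ`,
  `IsPolynomialRep ρ` applied to `ρ = weylRep k σ μ` the carrier must be passed explicitly,
  `(V := weylModule k σ μ)`: otherwise the unifier compares the `Module` instance of the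
  submodule before its `AddCommGroup` instance is known and, unfolding the quotient addition of
  `PiTensorProduct` down to `Quot.lift`, fails instead of postponing (this does not happen for
  submodules of `MvPolynomial`, e.g. G20's `formRep`). All statements below do so.
* Multiplicities are `hwMultiplicity` (a `Module.finrank`, junk `0` in infinite dimension). For
  `coordRep σ k m` with `m ≠ 0` over an infinite field a weight pins the degree, so every
  highest-weight space sits in one graded piece and is finite-dimensional
  (`finiteDimensional_highestWeightSpace_coordRep`); for `m = 0` the ring `k[Sym^0] = k[X]`
  carries the trivial action and `plethysmCoeff k σ 0 0` is junk `0`.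
* Which weight a partition-indexed coefficient uses is always said: `Weight.ofPartition` for
  the polynomial side (`V^{⊗d}`, Weyl modules), `Weight.dualOfPartition` for G20's coordinate
  rings (duals). On the matrix space `MatIdx m` the weight of a partition is transported along
  the lexicographic enumeration `matIdxEquiv m : Fin (m * m) ≃o MatIdx m` (an order
  isomorphism; `Weight.toMatIdx`); independence of the chosen linear order is NOT claimed
  (outline §4.5(b)), nor is a general `HasHighestWeight`-transport along `MvPolynomial.rename`.
* In the two theorems on `k[Δ(det_m)]` the partition is typed `λ : Nat.Partition (m * d)` (not
  `d * m`), so that BLMW's rectangle `Nat.Partition.rectangle m d : Nat.Partition (m * d)` is used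
  without a cast in the statement, and both carry / produce `λ.parts.card ≤ m * m` (needed because
  `Weight.dualOfPartition` truncates; review item 1).
* No separate "occurs in the orbit closure" predicate: occurrence of `V(χ)` in `k[Δ_m[f]]` is
  written `HasHighestWeight (orbitCoordRep f m) χ` directly (downstream **pnp.S28**).
-/

noncomputable section

open scoped BigOperators TensorProduct

namespace Literature.NumberTheory.DiophantineGeometry

/-! ### Tensor powers: the commuting actions of `S_d` and `GL(V)` -/

section TensorReps

variable (k V : Type*) [CommRing k] [AddCommGroup V] [Module k V] (d : ℕ)

/-- The representation of the symmetric group `S_d = Equiv.Perm (Fin d)` on the tensor power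
`V^{⊗d}` permuting the factors: `σ · (v_0 ⊗ ⋯ ⊗ v_{d-1}) = v_{σ⁻¹ 0} ⊗ ⋯ ⊗ v_{σ⁻¹ (d-1)}`
(Mathlib's `PiTensorProduct.reindex` along `σ`). Fulton–Harris §6.1 (the right action of `𝔖_d`
on `V^{⊗d}`, here turned into a left action). [folklore] -/
def permTensorRep : Representation k (Equiv.Perm (Fin d)) (TensorPower k d V) where
  toFun σ := (PiTensorProduct.reindex k (fun _ : Fin d ↦ V) σ).toLinearMap
  map_one' := by
    change (PiTensorProduct.reindex k _ (Equiv.refl _)).toLinearMap = _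
    rw [PiTensorProduct.reindex_refl]
    rfl
  map_mul' σ τ := by
    change (PiTensorProduct.reindex k _ (τ.trans σ)).toLinearMap = _
    rw [← PiTensorProduct.reindex_trans]
    rfl

/-- `permTensorRep` on a pure tensor: the factor in position `i` of `σ · ⨂ v` is `v (σ⁻¹ i)`.
Fulton–Harris §6.1. [folklore] -/
@[simp]
theorem permTensorRep_tprod (σ : Equiv.Perm (Fin d)) (v : Fin d → V) :
    permTensorRep k V d σ (PiTensorProduct.tprod k v) =
      PiTensorProduct.tprod k fun i => v (σ.symm i) :=
  PiTensorProduct.reindex_tprod σ v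

/-- The diagonal representation of `GL(V) = (V ≃ₗ[k] V)` on `V^{⊗d}`,
`g · (v_0 ⊗ ⋯ ⊗ v_{d-1}) = g v_0 ⊗ ⋯ ⊗ g v_{d-1}` (Mathlib's `PiTensorProduct.mapMonoidHom` on
the constant family `fun _ ↦ g`). Fulton–Harris §6.1. [folklore] -/
def diagTensorRep : Representation k (V ≃ₗ[k] V) (TensorPower k d V) :=
  (PiTensorProduct.mapMonoidHom (R := k) (s := fun _ : Fin d ↦ V)).comp
    (MonoidHom.pi fun _ ↦ LinearEquiv.automorphismGroup.toLinearMapMonoidHom)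

/-- `diagTensorRep g` is `PiTensorProduct.map` of the constant family `g` (unfolding lemma;
Fulton–Harris §6.1). [folklore] -/
theorem diagTensorRep_apply (g : V ≃ₗ[k] V) :
    diagTensorRep k V d g = PiTensorProduct.map fun _ : Fin d => (g : V →ₗ[k] V) :=
  rfl

/-- `diagTensorRep` on a pure tensor. Fulton–Harris §6.1. [folklore] -/
@[simp]
theorem diagTensorRep_tprod (g : V ≃ₗ[k] V) (v : Fin d → V) :
    diagTensorRep k V d g (PiTensorProduct.tprod k v) = PiTensorProduct.tprod k fun i => g (v i) :=
  PiTensorProduct.map_tprod _ v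

/-- The actions of `S_d` and `GL(V)` on `V^{⊗d}` commute. Fulton–Harris §6.1 (the starting
point of Schur–Weyl duality); Mathlib `PiTensorProduct.map_comp_reindex_eq`. [folklore] -/
theorem permTensorRep_comp_diagTensorRep (σ : Equiv.Perm (Fin d)) (g : V ≃ₗ[k] V) :
    permTensorRep k V d σ ∘ₗ diagTensorRep k V d g =
      diagTensorRep k V d g ∘ₗ permTensorRep k V d σ :=
  (PiTensorProduct.map_comp_reindex_eq (fun _ : Fin d => (g : V →ₗ[k] V)) σ).symm

/-- The actions of `S_d` and `GL(V)` on `V^{⊗d}` commute (the outline's name for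
`permTensorRep_comp_diagTensorRep`). Fulton–Harris §6.1. -/
alias perm_diag_comm := permTensorRep_comp_diagTensorRep

end TensorReps

section GLTensor

variable (σ k : Type*) [Fintype σ] [DecidableEq σ] [CommRing k] (d : ℕ)

/-- The `d`-th tensor power `(k^σ)^{⊗d}` of the standard *column* representation of
`GL σ k`: `g · (v_0 ⊗ ⋯ ⊗ v_{d-1}) = (g *ᵥ v_0) ⊗ ⋯ ⊗ (g *ᵥ v_{d-1})`. It is `diagTensorRep`
composed with Mathlib's `Matrix.GeneralLinearGroup.toLin : GL σ k ≃* GL(k^σ)` (whose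
underlying linear map is `Matrix.mulVecLin`, i.e. matrices act on column vectors) and
`LinearMap.GeneralLinearGroup.generalLinearEquiv`. **Convention check**: G20's `linSubst`
sends `X i ↦ ∑ j, g j i • X j`, i.e. the basis vector `e_i` to the `i`-th column `g *ᵥ e_i` of
`g`; so this is the same (standard column) representation and the same Borel applies.
Fulton–Harris §6.1, §15.5. [folklore] -/
def glTensorRep : Representation k (GL σ k) (TensorPower k d (σ → k)) :=
  (diagTensorRep k (σ → k) d).comp
    ((LinearMap.GeneralLinearGroup.generalLinearEquiv k (σ → k)).toMonoidHom.comp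
      (Matrix.GeneralLinearGroup.toLin (n := σ) (R := k)).toMonoidHom)

/-- `glTensorRep` on a pure tensor: each factor is multiplied by the matrix `g` (column
convention). Fulton–Harris §6.1. [folklore] -/
@[simp]
theorem glTensorRep_tprod (g : GL σ k) (v : Fin d → σ → k) :
    glTensorRep σ k d g (PiTensorProduct.tprod k v) =
      PiTensorProduct.tprod k fun i => (g : Matrix σ σ k).mulVec (v i) :=
  PiTensorProduct.map_tprod _ v

/-- The actions of `S_d` and `GL σ k` on `(k^σ)^{⊗d}` commute. Fulton–Harris §6.1, Lemma 6.22. [folklore] -/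
theorem permTensorRep_comp_glTensorRep (τ : Equiv.Perm (Fin d)) (g : GL σ k) :
    permTensorRep k (σ → k) d τ ∘ₗ glTensorRep σ k d g =
      glTensorRep σ k d g ∘ₗ permTensorRep k (σ → k) d τ :=
  permTensorRep_comp_diagTensorRep k (σ → k) d τ _

end GLTensor

/-! ### Weyl modules `S_μ(k^σ) = c_μ · (k^σ)^{⊗d}` -/

section Weyl

variable (k σ : Type*) [Field k] [Fintype σ] [LinearOrder σ] {d : ℕ}

/-- **Weyl's construction.** The Weyl module `S_μ(k^σ) = c_μ · (k^σ)^{⊗d} ⊆ (k^σ)^{⊗d}` of a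
partition `μ ⊢ d`: the image of the Young symmetrizer `c_μ ∈ k[S_d]` (`youngSymmetrizer k μ`)
acting on the tensor power through `permTensorRep`. Fulton–Harris §6.1 (before Thm 6.3);
Fulton, *Young Tableaux*, §8.1. [folklore] -/
def weylModule (μ : Nat.Partition d) : Submodule k (TensorPower k d (σ → k)) :=
  LinearMap.range ((permTensorRep k (σ → k) d).asAlgebraHom (youngSymmetrizer k μ))

/-- The action of the group algebra `k[S_d]` on `(k^σ)^{⊗d}` commutes with the action of
`GL σ k`. Fulton–Harris Lemma 6.22. [folklore] -/
theorem asAlgebraHom_permTensorRep_comp_glTensorRep (a : MonoidAlgebra k (Equiv.Perm (Fin d)))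
    (g : GL σ k) :
    (permTensorRep k (σ → k) d).asAlgebraHom a ∘ₗ glTensorRep σ k d g =
      glTensorRep σ k d g ∘ₗ (permTensorRep k (σ → k) d).asAlgebraHom a := by
  induction a using MonoidAlgebra.induction_on with
  | hM τ =>
    rw [Representation.asAlgebraHom_of]
    exact permTensorRep_comp_glTensorRep σ k d τ g
  | hadd a b ha hb => rw [map_add, LinearMap.add_comp, LinearMap.comp_add, ha, hb]
  | hsmul r a ha => rw [map_smul, LinearMap.smul_comp, LinearMap.comp_smul, ha]

/-- The Weyl module is stable under `GL σ k` (the two actions commute). This theorem supplies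
the hypothesis `h` of `weylRep`. Fulton–Harris §6.1, Lemma 6.22. [folklore] -/
theorem glTensorRep_mem_weylModule (μ : Nat.Partition d) (g : GL σ k)
    {x : TensorPower k d (σ → k)} (hx : x ∈ weylModule k σ μ) :
    glTensorRep σ k d g x ∈ weylModule k σ μ := by
  obtain ⟨y, rfl⟩ := hx
  refine ⟨glTensorRep σ k d g y, ?_⟩
  change ((permTensorRep k (σ → k) d).asAlgebraHom _ ∘ₗ glTensorRep σ k d g) y = _
  rw [asAlgebraHom_permTensorRep_comp_glTensorRep]
  rfl

/-- The Weyl representation `S_μ(k^σ)` of `GL σ k`: the restriction of `glTensorRep σ k d` to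
the Weyl module (Mathlib `Representation.subrepresentation`, as for G20's `formRep`), the
`GL`-stability being the proved theorem `glTensorRep_mem_weylModule k σ μ`.
Fulton–Harris Thm 6.3; Fulton, *Young Tableaux*, §8.1. [folklore] -/
def weylRep (μ : Nat.Partition d) : Representation k (GL σ k) (weylModule k σ μ) :=
  (glTensorRep σ k d).subrepresentation (weylModule k σ μ) fun g _ hx =>
    glTensorRep_mem_weylModule k σ μ g hx

/-- `weylRep` acts as `glTensorRep` on the underlying tensors (unfolding lemma;
Fulton–Harris §6.1). [folklore] -/
@[simp]
theorem coe_weylRep_apply (μ : Nat.Partition d) (g : GL σ k) (x : weylModule k σ μ) :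
    ((weylRep k σ μ g x : weylModule k σ μ) : TensorPower k d (σ → k)) =
      glTensorRep σ k d g x :=
  rfl

/-! ### The classical theorems on Weyl modules (statements) -/

/-- **Weyl modules are irreducible** in characteristic zero, provided `μ` has at most
`|σ| = dim V` parts (otherwise `S_μ(V) = 0`, `weylModule_eq_bot_iff`). Over `ℂ`:
Fulton–Harris Thm 6.3 (2); over a general field of characteristic zero the Weyl module is
absolutely irreducible (Green, LNM 830, Thm 5.4b / (2.6e)). [cite: FultonHarrisGTM129, Thm. 6.3 (4)] [cite: GreenLNM830, (5.4b) with (2.6e)] -/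
def isIrreducible_weylRep : Prop :=
  ∀ [CharZero k] (μ : Nat.Partition d) (hμ : μ.parts.card ≤ Fintype.card σ),
    Representation.IsIrreducible (V := weylModule k σ μ) (weylRep k σ μ)

/-- The Weyl module `S_μ(V)` vanishes iff `μ` has more than `dim V` parts.
Fulton–Harris Thm 6.3 (1); Fulton, *Young Tableaux*, §8.1, Thm 1. [cite: FultonHarrisGTM129, Thm. 6.3 (1)] [cite: FultonYoungTableaux1997, §8.1 Thm. 1] -/
def weylModule_eq_bot_iff : Prop :=
  ∀ [CharZero k] (μ : Nat.Partition d),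
    weylModule k σ μ = ⊥ ↔ Fintype.card σ < μ.parts.card

variable {k σ}

/-- **Highest weight of a Weyl module.** For `μ` with at most `N` parts, the Weyl module
`S_μ(k^N)` has exactly one highest weight, namely `μ = (μ_1, …, μ_N)` (`Weight.ofPartition`;
the highest-weight vector is `c_μ · (e_1^{⊗μ_1} ⊗ e_2^{⊗μ_2} ⊗ ⋯)` read along the rows of the
canonical tableau). Fulton–Harris Thm 15.47, §15.5; Fulton, *Young Tableaux*, §8.2, Thm 2. [cite: FultonYoungTableaux1997, §8.2 Thm. 2] -/
def hasHighestWeight_weylRep_iff : Prop :=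
  ∀ [CharZero k] {N : ℕ} (μ : Nat.Partition d) (hμ : μ.parts.card ≤ N) (χ : Weight (Fin N)),
    HasHighestWeight (V := weylModule k (Fin N) μ) (weylRep k (Fin N) μ) χ ↔
      χ = Weight.ofPartition N μ

/-- **Existence half of the highest-weight classification** (corollary of
`isIrreducible_weylRep` and `hasHighestWeight_weylRep_iff`, stated here and not in
`GLHighestWeight`): every polynomial weight `χ` of `GL_N` (dominant, nonnegative) is the highest
weight of an irreducible representation, namely the Weyl module `S_μ(k^N)` for the partition
`μ` with `Weight.ofPartition N μ = χ` (`Weight.existsUnique_eq_ofPartition`). Valid over any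
field of characteristic zero (the outline's `[IsAlgClosed k]` is not needed and is dropped).
Fulton–Harris Thm 15.47; Green, LNM 830, Thm 3.5a. [cite: FultonHarrisGTM129, Prop. 15.47 with Prop. 15.15] [cite: GreenLNM830, Thm. 3.5a] -/
def exists_isIrreducible_of_isPolynomial : Prop :=
  ∀ [CharZero k] {N : ℕ} (χ : Weight (Fin N)) (hχ : χ.IsPolynomial),
    ∃ (d : ℕ) (μ : Nat.Partition d),
      Representation.IsIrreducible (V := weylModule k (Fin N) μ) (weylRep k (Fin N) μ) ∧
        HasHighestWeight (V := weylModule k (Fin N) μ) (weylRep k (Fin N) μ) χ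

variable (k σ)

/-- The tensor power `(k^σ)^{⊗d}` is a polynomial representation of `GL σ k` (its matrix
coefficients are homogeneous polynomials of degree `d` in the entries). Green, LNM 830, §2.1,
(2.6a); Fulton–Harris §15.5. [cite: GreenLNM830, §2.1 (2.6a)] -/
def isPolynomialRep_glTensorRep : Prop :=
  ∀ (d : ℕ),
    IsPolynomialRep (glTensorRep σ k d)

/-- Weyl modules are polynomial representations (subrepresentations of `(k^σ)^{⊗d}`).
Green, LNM 830, §2.1, Ch. 5; Fulton–Harris §15.5. [cite: GreenLNM830, §2.1 and Ch. 5] -/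
def isPolynomialRep_weylRep : Prop :=
  ∀ (μ : Nat.Partition d),
    IsPolynomialRep (V := weylModule k σ μ) (weylRep k σ μ)

/-- **Schur–Weyl duality** (multiplicity form). For a partition `μ ⊢ d` with at most `N` parts,
the multiplicity of the highest weight `μ` in `(k^N)^{⊗d}` — i.e. of the irreducible `S_μ(k^N)`
— equals `f^μ = dim Specht(μ)`, the number of standard Young tableaux of shape `μ`:
`V^{⊗d} ≅ ⊕_μ S_μ(V) ⊗ Specht_μ`. Fulton–Harris Thm 6.3, Cor. 6.6 (with (4.11)); Fulton,
*Young Tableaux*, §8.2 Cor. [cite: FultonHarrisGTM129, Thm. 6.3 (2) and Cor. 6.6] [cite: FultonYoungTableaux1997, §8.2 Corollary] -/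
def hwMultiplicity_glTensorRep : Prop :=
  ∀ [CharZero k] {N : ℕ} (μ : Nat.Partition d) (hμ : μ.parts.card ≤ N),
    hwMultiplicity (glTensorRep (Fin N) k d) (Weight.ofPartition N μ) = numStandardTableaux μ

/-- Highest weights of `(k^N)^{⊗d}` in characteristic zero are exactly the partitions of `d`
with at most `N` parts (the "only such μ occur" half of Schur–Weyl duality).
Fulton–Harris Thm 6.3; Fulton, *Young Tableaux*, §8.2. [cite: FultonHarrisGTM129, Thm. 6.3] -/
def hasHighestWeight_glTensorRep_iff : Prop :=
  ∀ [CharZero k] {N : ℕ} (d : ℕ) (χ : Weight (Fin N)),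
    HasHighestWeight (glTensorRep (Fin N) k d) χ ↔
      ∃ μ : Nat.Partition d, μ.parts.card ≤ N ∧ χ = Weight.ofPartition N μ

end Weyl

/-! ### Plethysm and orbit-closure multiplicities on G20's coordinate rings -/

section Plethysm

open MvPolynomial

variable (k σ : Type*) [Field k] [Fintype σ] [LinearOrder σ]

/-- The *plethysm coefficient* attached to a weight `χ` and a degree `m`: the multiplicity
`hwMultiplicity` of the highest weight `χ` in G20's representation `coordRep σ k m` of `GL σ k`
on the coordinate ring `k[Sym^m (k^σ)] = ⊕_d Sym^d (Sym^m (k^σ))^*` (`(g · F)(v) = F(g⁻¹ v)`).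
Since `coordRep` is a sum of *duals* of polynomial representations, for a partition `λ ⊢ d·m`
the classical plethysm coefficient (multiplicity of `V(λ)` in `Sym^d (Sym^m V)`,
`V = k^N`) is `plethysmCoeff k (Fin N) m (Weight.dualOfPartition N λ)`
(`plethysmCoeffOfPartition`); the degree `d` is forced by the weight (its size is `-d·m`).
Junk: for `m = 0` the ring `k[Sym^0] = k[X]` carries the trivial action and the value at
`χ = 0` is the `finrank` junk `0`; for `m ≠ 0` over an infinite field the highest-weight space
is finite-dimensional (`finiteDimensional_highestWeightSpace_coordRep`).
BLMW, SIAM J. Comput. 40 (2011), §4.4, §5.2; Fulton–Harris §6.1 (plethysm), Ex. 6.17. [folklore] -/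
def plethysmCoeff (m : ℕ) (χ : Weight σ) : ℕ :=
  hwMultiplicity (Literature.Computability.AlgebraicComplexity.coordRep σ k m) χ

/-- The plethysm coefficient of a partition `λ` for `GL_N`: the multiplicity of the dual Weyl
module `V(λ)^*`, i.e. of the highest weight `Weight.dualOfPartition N λ = (0,…,0,-λ_ℓ,…,-λ_1)`,
in `k[Sym^m (k^N)] = ⊕_d Sym^d (Sym^m (k^N))^*`; for `λ ⊢ n = d·m` with at most `N` parts this
is the classical plethysm coefficient of `V(λ)` in `Sym^d (Sym^m (k^N))` (and `0` if `m ∤ n`,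
`m ≠ 0`). Uses `Weight.dualOfPartition` (dual convention of `coordRep`). **Junk**: this
definition carries no hypothesis, so for `λ` with more than `N` parts the value is the
coefficient of the *truncated* weight (first `N` parts of `λ`, inherited from
`Weight.dualOfPartition`), not `0`; theorems using it must carry `λ.parts.card ≤ N`.
BLMW 2011 §4.4, (5.2.2); Fulton–Harris Ex. 6.17. [cite: BLMW2011, §4.4  (5.2.2] -/
def plethysmCoeffOfPartition (N m : ℕ) {n : ℕ} (lam : Nat.Partition n) : ℕ :=
  plethysmCoeff k (Fin N) m (Weight.dualOfPartition N lam)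

variable {σ} in
/-- The multiplicity of the highest weight `χ` in the coordinate ring `k[Δ_m[f]]` of the orbit
closure of a form `f` (G20's `orbitCoordRep f m`), i.e. — by complete reducibility in
characteristic zero — the multiplicity of the irreducible `V(χ)` in `k[Δ_m[f]]`. Occurrence is
written `HasHighestWeight (orbitCoordRep f m) χ` directly (no separate predicate).
Mulmuley–Sohoni 2001 §5; BLMW 2011 §5.2; Bürgisser–Ikenmeyer STOC 2011 §2. [cite: MulmuleySohoni2001, §5] -/
def orbitMultiplicity (f : MvPolynomial σ k) (m : ℕ) (χ : Weight σ) : ℕ :=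
  hwMultiplicity (Literature.Computability.AlgebraicComplexity.orbitCoordRep f m) χ

variable {k σ}

/-- **A weight pins the degree.** For `m ≠ 0` over an infinite field, every highest-weight space
of `coordRep σ k m` is finite-dimensional: the scalar matrix `t • 1` acts on the degree-`d`
piece of `k[Sym^m]` by `t ^ (-(d m))` and through `weightChar χ` by `t ^ χ.size`, so a
`B`-semi-invariant of weight `χ` is concentrated in the single degree `d = -χ.size / m`. Hence
`plethysmCoeff` never meets the `finrank` junk value for `m ≠ 0`. (False for `m = 0`, where the
action on `k[X]` is trivial, and over finite fields.) BLMW 2011 §4.4; Green, LNM 830, §2.2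
(degree = weight of the centre). [cite: BLMW2011, §4.4] -/
def finiteDimensional_highestWeightSpace_coordRep : Prop :=
  ∀ [Infinite k] {m : ℕ} (hm : m ≠ 0) (χ : Weight σ),
    FiniteDimensional k (highestWeightSpace (Literature.Computability.AlgebraicComplexity.coordRep σ k m) χ)

/-- The same for the coordinate ring of an orbit closure: for `m ≠ 0` over an infinite field the
highest-weight spaces of `orbitCoordRep f m` are finite-dimensional (a weight pins the degree in
the graded quotient `k[Sym^m] ⧸ I(GL · f)`). BLMW 2011 §5.2. [cite: BLMW2011, §5.2] -/
def finiteDimensional_highestWeightSpace_orbitCoordRep : Prop :=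
  ∀ [Infinite k] (f : MvPolynomial σ k) {m : ℕ} (hm : m ≠ 0) (χ : Weight σ),
    FiniteDimensional k (highestWeightSpace (Literature.Computability.AlgebraicComplexity.orbitCoordRep f m) χ)

/-- The quotient map `k[Sym^m] ↠ k[Δ_m[f]] = k[Sym^m] ⧸ I(GL · f)` intertwines `coordRep σ k m`
and `orbitCoordRep f m` (it is `GL`-equivariant by construction, `orbitCoordSubst_mk`).
Mulmuley–Sohoni 2001 §5. [cite: MulmuleySohoni2001, §5] -/
theorem mkₐ_comp_coordRep (f : MvPolynomial σ k) (m : ℕ) (g : GL σ k) :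
    (Ideal.Quotient.mkₐ k (Literature.Computability.AlgebraicComplexity.orbitVanishingIdeal f m)).toLinearMap ∘ₗ Literature.Computability.AlgebraicComplexity.coordRep σ k m g =
      Literature.Computability.AlgebraicComplexity.orbitCoordRep f m g ∘ₗ (Ideal.Quotient.mkₐ k (Literature.Computability.AlgebraicComplexity.orbitVanishingIdeal f m)).toLinearMap :=
  LinearMap.ext fun _ => rfl

/-- **BLMW upper bound by plethysm.** For a form `f` of degree `m ≠ 0` (characteristic zero), the
multiplicity of `V(χ)` in the coordinate ring `k[Δ_m[f]]` of its orbit closure is at most its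
multiplicity in `k[Sym^m (k^σ)]`, i.e. the plethysm coefficient: `k[Δ_m[f]]` is a
`GL`-equivariant quotient of `k[Sym^m]` and both are completely reducible, degreewise
finite-dimensional (`m ≠ 0` is needed: for `m = 0` the left side is `1` at `χ = 0` while the
right side is the `finrank` junk `0`; the homogeneity hypothesis restricts to the meaningful case
of G20's orbit closures and is the outline's signature). BLMW, SIAM J. Comput. 40 (2011), §4.4
(Prop. 4.4.1) and §5.2; Bürgisser–Ikenmeyer, STOC 2011, §2. [cite: STOC2011, §2] -/
def orbitMultiplicity_le_plethysmCoeff : Prop :=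
  ∀ [CharZero k] (f : MvPolynomial σ k) {m : ℕ} (hm : m ≠ 0) (hf : f.IsHomogeneous m) (χ : Weight σ),
    orbitMultiplicity k f m χ ≤ plethysmCoeff k σ m χ

/-- An irreducible occurring in `k[Δ_m[f]]` occurs in `k[Sym^m (k^σ)]` (occurrence form of
`orbitMultiplicity_le_plethysmCoeff`, characteristic zero, `m ≠ 0`). BLMW 2011 §4.4, §5.2. [cite: BLMW2011, §4.4  §5.2] -/
def hasHighestWeight_coordRep_of_orbitCoordRep : Prop :=
  ∀ [CharZero k] (f : MvPolynomial σ k) {m : ℕ} (hm : m ≠ 0) (hf : f.IsHomogeneous m) {χ : Weight σ} (h : HasHighestWeight (Literature.Computability.AlgebraicComplexity.orbitCoordRep f m) χ),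
    HasHighestWeight (Literature.Computability.AlgebraicComplexity.coordRep σ k m) χ

/-- **Highest weights of `k[Sym^m (k^N)]` are duals of partitions.** In characteristic zero, if
`V(χ)` occurs in `k[Sym^m (k^N)] = ⊕_n Sym^n (Sym^m (k^N))^*` then `χ = λ^* =
Weight.dualOfPartition N λ` for a partition `λ ⊢ n·m` with at most `N` parts (the irreducible
constituents of `Sym^n (Sym^m V)` are polynomial of degree `n m`). BLMW 2011 §4.4, (5.2.2);
Fulton–Harris §6.1, §15.5. [cite: BLMW2011, §4.4  (5.2.2] -/
def exists_eq_dualOfPartition_of_hasHighestWeight_coordRep : Prop :=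
  ∀ [CharZero k] {N m : ℕ} {χ : Weight (Fin N)} (h : HasHighestWeight (Literature.Computability.AlgebraicComplexity.coordRep (Fin N) k m) χ),
    ∃ (n : ℕ) (lam : Nat.Partition (n * m)), lam.parts.card ≤ N ∧
      χ = Weight.dualOfPartition N lam

end Plethysm

/-! ### Matrix spaces with the lexicographic Borel: determinant and padded permanent -/

section MatrixSpaces

open MvPolynomial

/-- The index type `Fin m ×ₗ Fin m` of the entries of an `m × m` matrix, with the
**lexicographic** linear order (Mathlib `Lex`, `Prod.Lex.instLinearOrder`), so that
`GL (MatIdx m) k = GL_{m²}(k)` has the upper triangular Borel subgroup of `GLHighestWeight`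
(`Fin m × Fin m` itself carries only the product partial order). BLMW 2011 §5;
Bürgisser–Ikenmeyer–Panova 2019 §2 (outline §4.5(b): independence of the order is not
claimed). [cite: BLMW2011, §5] -/
abbrev MatIdx (m : ℕ) : Type :=
  Fin m ×ₗ Fin m

/-- The row-major enumeration `Fin (m * m) ≃ Fin m × Fin m`, `n ↦ (n / m, n % m)` (Mathlib
`finProdFinEquiv.symm`) followed by `toLex` is strictly monotone for the lexicographic order
(row-major order is the lexicographic order). Elementary; used to bundle `matIdxEquiv`. [folklore] -/
theorem strictMono_toLex_comp_finProdFinEquiv_symm (m : ℕ) :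
    StrictMono (finProdFinEquiv.symm.trans toLex : Fin (m * m) ≃ MatIdx m) := by
  intro a b hab
  simp only [Equiv.trans_apply, Prod.Lex.toLex_lt_toLex, finProdFinEquiv_symm_apply,
    Fin.lt_def, Fin.ext_iff, Fin.coe_divNat, Fin.coe_modNat]
  rcases lt_or_ge (a / m : ℕ) (b / m) with h | h
  · exact Or.inl h
  · right
    have hle : (a : ℕ) / m ≤ b / m := Nat.div_le_div_right (le_of_lt hab)
    have heq : (a : ℕ) / m = b / m := le_antisymm hle h
    refine ⟨heq, ?_⟩
    have ha := Nat.div_add_mod (a : ℕ) m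
    have hb := Nat.div_add_mod (b : ℕ) m
    rw [heq] at ha
    have : (a : ℕ) < b := hab
    omega

/-- The lexicographic enumeration `Fin (m * m) ≃o Fin m ×ₗ Fin m`, `n ↦ (n / m, n % m)`
(Mathlib `finProdFinEquiv.symm` followed by `toLex`), bundled as an order isomorphism; used to
transport `Fin`-indexed weights of partitions to the matrix space compatibly with the two upper
triangular Borel subgroups. BLMW 2011 §5.2. [cite: BLMW2011, §5.2] -/
def matIdxEquiv (m : ℕ) : Fin (m * m) ≃o MatIdx m where
  toEquiv := finProdFinEquiv.symm.trans toLex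
  map_rel_iff' := (strictMono_toLex_comp_finProdFinEquiv_symm m).le_iff_le

/-- `matIdxEquiv m n = toLex (n / m, n % m)` (unfolding lemma). [folklore] -/
@[simp]
theorem matIdxEquiv_apply (m : ℕ) (n : Fin (m * m)) :
    matIdxEquiv m n = toLex (finProdFinEquiv.symm n) :=
  rfl

/-- The lexicographic enumeration `matIdxEquiv m` is strictly monotone. Immediate from the
bundling. [folklore] -/
theorem matIdxEquiv_strictMono (m : ℕ) : StrictMono (matIdxEquiv m) :=
  (matIdxEquiv m).strictMono

/-- Transport of a weight of `GL_{m²}` indexed by `Fin (m * m)` to the matrix index type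
`MatIdx m` along the lexicographic enumeration `matIdxEquiv m`. BLMW 2011 §5.2. [cite: BLMW2011, §5.2] -/
def Weight.toMatIdx {m : ℕ} (χ : Weight (Fin (m * m))) : Weight (MatIdx m) :=
  fun ij => χ ((matIdxEquiv m).symm ij)

variable (k : Type*) [Field k]

/-- The generic determinant `det_m` as a form of degree `m` in the lexicographically ordered
matrix variables `MatIdx m`: G20's `detPoly (Fin m) k` transported along `rename toLex`.
Mulmuley–Sohoni 2001 §4; BLMW 2011 §5. [cite: MulmuleySohoni2001, §4] -/
def detFormLex (m : ℕ) : MvPolynomial (MatIdx m) k :=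
  rename toLex (Literature.Computability.AlgebraicComplexity.detPoly (Fin m) k)

/-- The padded permanent `X₀₀^(m-n) per_n` as a form of degree `m` in the lexicographically
ordered matrix variables `MatIdx m`: G20's `paddedPerPoly k n m` transported along
`rename toLex` (junk for `n > m` as in `paddedPerPoly`). Mulmuley–Sohoni 2001 §4;
Bürgisser–Ikenmeyer–Panova 2019 §1. [cite: MulmuleySohoni2001, §4] -/
def paddedPerFormLex (n m : ℕ) [NeZero m] : MvPolynomial (MatIdx m) k :=
  rename toLex (Literature.Computability.AlgebraicComplexity.paddedPerPoly k n m)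

/-- `detFormLex` is homogeneous of degree `m`. Immediate from G20's `detPoly_isHomogeneous` and
`IsHomogeneous.rename`. [folklore] -/
theorem detFormLex_isHomogeneous (m : ℕ) : (detFormLex k m).IsHomogeneous m := by
  have h := (Literature.Computability.AlgebraicComplexity.detPoly_isHomogeneous (n := Fin m) (k := k)).rename_isHomogeneous (f := toLex)
  rwa [Fintype.card_fin] at h

/-- `paddedPerFormLex` is homogeneous of degree `m` for `n ≤ m`. Immediate from G20's
`paddedPerPoly_isHomogeneous`. [folklore] -/
theorem paddedPerFormLex_isHomogeneous {n m : ℕ} [NeZero m] (h : n ≤ m) :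
    (paddedPerFormLex k n m).IsHomogeneous m :=
  (Literature.Computability.AlgebraicComplexity.paddedPerPoly_isHomogeneous (k := k) h).rename_isHomogeneous

/-- The `GL_{m²}`-representation on the coordinate ring `k[Δ(det_m)] = k[\overline{GL_{m²} · det_m}]`
of the orbit closure of the determinant (G20's `orbitCoordRep` of `detFormLex k m` in degree
`m`). Mulmuley–Sohoni 2001 §5; BLMW 2011 §5.2; Bürgisser–Ikenmeyer–Panova 2019 §2. [cite: MulmuleySohoni2001, §5] -/
def detOrbitRep (m : ℕ) :
    Representation k (GL (MatIdx m) k) (Literature.Computability.AlgebraicComplexity.OrbitCoordRing (detFormLex k m) m) :=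
  Literature.Computability.AlgebraicComplexity.orbitCoordRep (detFormLex k m) m

/-- The `GL_{m²}`-representation on the coordinate ring `k[Δ(X₀₀^(m-n) per_n)]` of the orbit
closure of the padded permanent (G20's `orbitCoordRep` of `paddedPerFormLex k n m` in degree
`m`). Mulmuley–Sohoni 2001 §5; Bürgisser–Ikenmeyer–Panova 2019 §2. [cite: MulmuleySohoni2001, §5] -/
def paddedPerOrbitRep (n m : ℕ) [NeZero m] :
    Representation k (GL (MatIdx m) k) (Literature.Computability.AlgebraicComplexity.OrbitCoordRing (paddedPerFormLex k n m) m) :=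
  Literature.Computability.AlgebraicComplexity.orbitCoordRep (paddedPerFormLex k n m) m

variable {k}

/-- Orbit closures are transported along renaming of variables by an equivalence: for
`e : σ ≃ τ`, `rename e g ∈ Δ[rename e f] ↔ g ∈ Δ[f]` (`rename e` conjugates `GL σ k` onto
`GL τ k` and is a homeomorphism of coefficient spaces for the Zariski topology).
Mulmuley–Sohoni 2001 §4. [cite: MulmuleySohoni2001, §4] -/
def rename_mem_orbitClosure_rename_iff : Prop :=
  ∀ {σ τ : Type*} [Fintype σ] [DecidableEq σ] [Fintype τ] [DecidableEq τ] (e : σ ≃ τ) (f g : MvPolynomial σ k),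
    rename e g ∈ Literature.Computability.AlgebraicComplexity.orbitClosure (rename e f) ↔ g ∈ Literature.Computability.AlgebraicComplexity.orbitClosure f

/-- G20's `HasBorderDetRepr k n m` (the padded permanent lies in `Δ[det_m]`, variables
`Fin m × Fin m`) is equivalent to the same statement in the lexicographically ordered variables
`MatIdx m`. Transport of `orbitClosure` along `rename toLex`
(`rename_mem_orbitClosure_rename_iff`). Mulmuley–Sohoni 2001 §4 (Conj. 4.3). [cite: MulmuleySohoni2001, §4 (Conj. 4.3] -/
def hasBorderDetRepr_iff_rename : Prop :=
  ∀ (n m : ℕ) [NeZero m],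
    Literature.Computability.AlgebraicComplexity.HasBorderDetRepr k n m ↔ paddedPerFormLex k n m ∈ Literature.Computability.AlgebraicComplexity.orbitClosure (detFormLex k m)

/- interim proof relied on results that are now named facts (D-0014); demoted to a fact by the M5 import, proof preserved:
:=
  (rename_mem_orbitClosure_rename_iff toLex (detPoly (Fin m) k) (paddedPerPoly k n m)).symm
-/

/-- **BLMW's Kronecker bound for the determinant orbit.** In characteristic zero, for a
partition `λ ⊢ m·d` with at most `m²` parts, the multiplicity of `V(λ)^*` (highest weight
`Weight.dualOfPartition (m*m) λ`, transported to `MatIdx m`) in the degree-`d` part of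
`k[Δ(det_m)]` — hence in `k[Δ(det_m)]`, the weight pinning the degree — is at most the
rectangular Kronecker coefficient `g(λ, m × d, m × d)` (`kroneckerCoeff`, with
`Nat.Partition.rectangle m d = (d,…,d)`, `m` parts; `λ` is typed `Nat.Partition (m * d)` so
that no cast is needed): `k[Δ(det_m)]_d ⊆ k[GL_{m²} · det_m]_d` and the latter has
multiplicities the *symmetric* rectangular Kronecker coefficients
`sk(λ, m × d) ≤ g(λ, m × d, m × d)`.
Hypothesis `hlam : λ.parts.card ≤ m * m`: automatic for every `λ` occurring in a quotient of
`k[Sym^m k^{m²}]` (BLMW (5.2.2), `exists_eq_toMatIdx_of_hasHighestWeight_detOrbitRep`), so not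
a weakening; it is needed formally because `Weight.dualOfPartition N μ` truncates `μ` to its
first `N` parts, and without it the statement is false (`m = 1`, `d = 2`, `λ = (1,1)`: the
truncated weight `(-1)` has multiplicity `1` in `k[Δ(det_1)] = k[Y]` while
`g((1,1),(2),(2)) = 0`). BLMW, SIAM J. Comput. 40 (2011), Prop. 5.2.1 with (5.2.2)–(5.2.5);
Bürgisser–Ikenmeyer, STOC 2011, Thm 4.3. [cite: STOC2011, Thm 4.3] -/
def orbitMultiplicity_det_le_kroneckerCoeff : Prop :=
  ∀ [CharZero k] {m d : ℕ} (lam : Nat.Partition (m * d)) (hlam : lam.parts.card ≤ m * m),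
    orbitMultiplicity k (detFormLex k m) m (Weight.dualOfPartition (m * m) lam).toMatIdx ≤
      kroneckerCoeff k lam (Nat.Partition.rectangle m d) (Nat.Partition.rectangle m d)

/-- Highest weights occurring in `k[Δ(det_m)]` are duals of partitions `λ ⊢ m·d` (`d` the
degree) with at most `m²` parts (transported to `MatIdx m`); occurrence form combining
`hasHighestWeight_coordRep_of_orbitCoordRep` and
`exists_eq_dualOfPartition_of_hasHighestWeight_coordRep` on the matrix space (`λ` typed
`Nat.Partition (m * d)` to feed `orbitMultiplicity_det_le_kroneckerCoeff` directly; the case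
`m = 0` holds with `d = 0`, so no `m ≠ 0` hypothesis). BLMW 2011 §5.2, (5.2.2). [cite: BLMW2011, §5.2  (5.2.2] -/
def exists_eq_toMatIdx_of_hasHighestWeight_detOrbitRep : Prop :=
  ∀ [CharZero k] {m : ℕ} {χ : Weight (MatIdx m)} (h : HasHighestWeight (detOrbitRep k m) χ),
    ∃ (d : ℕ) (lam : Nat.Partition (m * d)), lam.parts.card ≤ m * m ∧
      χ = (Weight.dualOfPartition (m * m) lam).toMatIdx

end MatrixSpaces

end Literature.NumberTheory.DiophantineGeometry
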